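import Summits.BirchSwinnertonDyer.Rank1Residual.X11b.BDPRouteFinal
import Summits.BirchSwinnertonDyer.Rank1Residual.X11b.ChaRoute
import Literature.NumberTheory.Automorphic.ShimuraCurveRibetTakahashiOptimalModularityProofs
import Literature.NumberTheory.Automorphic.ShimuraCurveRibetTakahashiFreyManinProofs
import Literature.NumberTheory.EllipticCurves.ManinConstantSemistablePrimewise
import Literature.NumberTheory.EllipticCurves.RationalIsogenyDegreesProofs
import Literature.NumberTheory.EllipticCurves.OpenImageMazurAssemblyProofs
import Literature.NumberTheory.EllipticCurves.HeegnerPointsRationalityProofs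
import Literature.NumberTheory.EllipticCurves.HeegnerPointsProofs
import Literature.NumberTheory.EllipticCurves.HeegnerPointsClassesProofs
import HarnessLib

/-!
# Class X11b, route "BDP + converse-theorem engine + Kolyvagin": the Manin-unit Heegner datum, and the sub-cell target from STEP L alone (cell `b2b-bsdres`, sub-cell `multr1-p2`)

HONEST FRAMING (cell `b2b-bsdres`, run/shared/lean/b2b/bsd-rank1-residual/, verbatim in every
file): the goal of the cell is to DELETE the COMBINATION-SHAPED residual classes of the
Birch–Swinnerton-Dyer formula for ALL analytic-rank `≤ 1` elliptic curves over `ℚ` — "full BSD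
formula for every rank `≤ 1` curve in class `C`" assembled STRICTLY from published theorems — so
that the rank-`≤ 1` remainder becomes exactly the CONSTRUCTION-SHAPED classes, which are TYPED
(missing-input `Prop`s), NOT attempted. This is not "finishing BSD". Sub-cell `multr1-p2` is a
RESEARCH ROUTE on class X11b; no claim beyond the stated class and locus; X11b's label does not
change.

THEOREMS ONLY (no definition, no named fact). `X11b/BDPRouteFinal.lean` reduced the sub-cell target
of record `X11b.Statement` ("for every `(E,p)` in X11b with `p ≥ 5`, a (ram) prime and
`p ∤ ∏ c_ℓ`, Miller's `BSD(E,p)`") to the typed input STEP L (`IndexLowerBoundAt`, OPEN at `p ∥ N`),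
the published named facts of the tree, and ONE routine binder `hMan`: a Heegner point over `K` of a
modular-parametrisation datum of `E` at level `N` whose Manin constant is prime to `p`. This file
DISCHARGES `hMan` from published named facts of the tree (`exists_maninDatum`), so that the target
reads `X11b.Statement ⇐ STEP L + published facts` with no transport binder left
(`statement_of_indexLowerBoundAt`).

The argument for `hMan` (every `(E, p)` with `E[p]` irreducible, `p` odd, `p² ∤ N`; Jetchev–Skinner–Wan
2017, §7.4.1 p. 30 with Remark 43: "`c_E ∈ ℤ` is the Manin constant of `E` (so `p ∤ c_E` in this
case)"):

* the `X₀(N)`-optimal curve `E₀ ~ E` of the class with its optimal datum `D₀`, `Λ_{E₀} = c₀ Λ_f`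
  (the tree's `exists_optimal_modularParametrizationData`, here DERIVED from the Modularity theorem
  `exists_isNewformOf` by `exists_optimal_modularParametrizationData_of_modularity`, Edixhoven's
  integrality being a theorem of the tree), and `p ∤ c₀` by **Mazur 1978, Cor. 4.1** (named fact
  `mazur_not_dvd_maninConstant_of_odd`: odd `p`, `p² ∤ N`);
* a cyclic `ℚ`-isogeny `ψ : E → E₀` (Silverman AEC III.4.11, tree theorem
  `IsIsogenous.exists_isCyclic`) has degree prime to `p`, because `E[p] ∩ ker ψ` is a `Γ_ℚ`-stable
  subgroup of the irreducible `E[p]`, hence `0` (Cauchy) or `E[p]` (not cyclic)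
  (`not_dvd_degree_of_isCyclic_of_irr`, the argument of the tree's
  `mem_mazurPrimes_of_prime_dvd_degree` with irreducibility as the hypothesis);
* its rational multiplier `q`, `qΛ_E ⊆ Λ_{E₀}`, has `[Λ_{E₀} : qΛ_E] = deg ψ` (Silverman AEC
  VI.4.1(b), tree theorem `degree_eq_natCard_ker_mulQuotientMap_of_baseChange_eq_curve`), so
  `(deg ψ / q) Λ_{E₀} ⊆ Λ_E`; both `q` and `k = deg ψ / q` are integers by the **Néron mapping
  property** for the two globally minimal models (named fact
  `integral_neronScaling_of_isGloballyMinimal`, Silverman ATAEC IV.5.1, IV.6.1, Cor. IV.9.1), so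
  `k ∣ deg ψ` and `p ∤ k` (`exists_int_mul_mem_lattice_not_dvd`);
* `(f, Λ_E, k c₀)` is a datum of `E` at level `N` with `p ∤ k c₀`
  (`exists_modularParametrizationData_not_dvd`; tree theorem
  `ModularParametrizationData.exists_of_isNewformOf`), and for every datum the Heegner point
  `∑_Q φ(τ_Q)` is `K`-rational (tree theorems `exists_dvd_sq_sub_discr_holds`,
  `nonempty_heegnerDatum_holds`, `heegnerPointComplex_mem_range_map_holds`: Gross 1984, Darmon 2004
  Thm. 3.6).

So the published inputs of the sub-cell target are now: Gross–Zagier, Kolyvagin (×2), Skinner 2016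
Thm. C, Gross–Zagier–Kolyvagin over `ℚ`, modularity (×2), Friedberg–Hoffstein, Mazur 1978 Cor. 4.1,
and the Néron mapping property for minimal models; the ONE typed input is STEP L (`IndexLowerBoundAt`
at `p ∥ N`: no refereed proof — Castella 2018 Thm. 4.4 withdrawn, replacement via Fouquet–Wan 2021
unrefereed; see `X11b/BDPRoute.lean`). X11b stays CONSTRUCTION-SHAPED.

References: [JetchevSkinnerWan2017] §7.4.1, Remark 43; [Mazur1978] Cor. 4.1; [AgasheRibetStein2006]
Thm. 2.6, §2; [SilvermanATAEC1994] IV.5.1, IV.6.1, Cor. IV.9.1; [SilvermanAEC2009] III.4.11,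
Thm. VI.4.1; [Darmon2004] Thm. 3.6; [Miller2011LMS] Def. 1.1.
-/

noncomputable section

open scoped Classical

open WeierstrassCurve NumberField Literature.NumberTheory.EllipticCurves
  Literature.NumberTheory.EllipticCurves.ModularForms
  Literature.NumberTheory.EllipticCurves.Rank1Residual
  Literature.NumberTheory.Automorphic

namespace Summit.BirchSwinnertonDyer.Rank1Residual.X11b

/-! ### A cyclic isogeny out of a curve with irreducible `E[p]` has degree prime to `p` -/

/-- **`p ∤ deg ψ` for a cyclic `ℚ`-isogeny `ψ : E → E'` when `E[p]` is irreducible.**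
`H = E[p] ∩ ker ψ` is a `Γ_ℚ`-stable subgroup of `E[p]` (`ψ` is `Γ_ℚ`-equivariant), so `H = 0` or
`H = E[p]` by irreducibility; if `p ∣ deg ψ = #ker ψ`, Cauchy's theorem gives a point of order `p` in
the kernel, so `H ≠ 0`; and `H = E[p]` would make `E[p] ≤ ker ψ` cyclic, impossible for a group of
order `p²` and exponent `p` (Silverman AEC III.6.4(b)). This is the argument of the tree's
`mem_mazurPrimes_of_prime_dvd_degree` with the irreducibility of `E[p]` as the hypothesis in place
of Mazur's theorem. [cite: SilvermanAEC2009, III.4 (Prop. III.4.12) and Cor. III.6.4(b)] -/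
theorem not_dvd_degree_of_isCyclic_of_irr {W W' : WeierstrassCurve ℚ} [W.IsElliptic]
    (φ : Isogeny W W') (hφ : φ.IsCyclic) {p : ℕ} (hp : p.Prime)
    (hirr : W.HasIrreducibleModPGaloisRep p) : ¬ p ∣ φ.degree := by
  intro hpd
  haveI : Fact p.Prime := ⟨hp⟩
  -- `H = E[p] ∩ ker φ`, a `Γ_ℚ`-stable subgroup of `E[p]`
  set H : AddSubgroup (geomTorsion W (p : ℤ)) :=
    (φ.toAddMonoidHom.comp (geomTorsion W (p : ℤ)).subtype).ker with hH
  have hHmem : ∀ P : geomTorsion W (p : ℤ), P ∈ H ↔ φ (P : W.geomPoints) = 0 := fun P ↦ by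
    rw [hH, AddMonoidHom.mem_ker]
    rfl
  have hstab : ∀ σ : Field.absoluteGaloisGroup ℚ, ∀ P ∈ H, σ • P ∈ H := fun σ P hP ↦ by
    rw [hHmem] at hP ⊢
    rw [AddSubgroup.torsionBy.coe_smul, φ.map_smul, hP, smul_zero]
  rcases hirr H hstab with hbot | htop
  · -- Cauchy: `ker φ` has an element of order `p`, a non-zero point of `E[p] ∩ ker φ`
    obtain ⟨Q, hQ⟩ := exists_prime_addOrderOf_dvd_card' (G := φ.toAddMonoidHom.ker) p hpd
    have hQp : p • ((Q : φ.toAddMonoidHom.ker) : W.geomPoints) = 0 := by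
      have h := congrArg Subtype.val (addOrderOf_nsmul_eq_zero Q)
      rwa [hQ, AddSubmonoidClass.coe_nsmul] at h
    have hQ0 : ((Q : φ.toAddMonoidHom.ker) : W.geomPoints) ≠ 0 := fun h0 ↦ by
      rw [show Q = 0 from Subtype.ext h0, addOrderOf_zero] at hQ
      exact hp.one_lt.ne hQ
    have hmemH : (⟨(Q : W.geomPoints), AddSubgroup.torsionBy.nsmul_iff.mpr hQp⟩ :
        geomTorsion W (p : ℤ)) ∈ H := (hHmem _).mpr ((AddMonoidHom.mem_ker).mp Q.2)
    rw [hbot, AddSubgroup.mem_bot] at hmemH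
    exact hQ0 (congrArg Subtype.val hmemH)
  · -- `E[p] ≤ ker φ` would make `E[p]` cyclic, but it has exponent `p` and order `p²`
    have hle : geomTorsion W (p : ℤ) ≤ φ.toAddMonoidHom.ker := fun P hP ↦
      (AddMonoidHom.mem_ker).mpr ((hHmem ⟨P, hP⟩).mp (htop ▸ AddSubgroup.mem_top _))
    haveI : IsAddCyclic φ.toAddMonoidHom.ker := hφ
    haveI : IsAddCyclic (geomTorsion W (p : ℤ)) := AddSubgroup.isAddCyclic_of_le hle
    have hdvd : AddMonoid.exponent (geomTorsion W (p : ℤ)) ∣ p :=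
      AddMonoid.exponent_dvd_of_forall_nsmul_eq_zero fun P ↦ AddSubgroup.torsionBy.nsmul P
    rw [IsAddCyclic.exponent_eq_card,
      natCard_geomTorsion_eq_sq W (Nat.cast_ne_zero.mpr hp.ne_zero)] at hdvd
    have h1 := Nat.le_of_dvd hp.pos hdvd
    have h2 := hp.two_le
    nlinarith

/-! ### An integral multiplier prime to `p` between the Néron lattices of isogenous minimal models -/

/-- **Between the Néron lattices of two `ℚ`-isogenous GLOBALLY MINIMAL elliptic curves `E₀ ~ E`
with `E[p]` irreducible there is an integral multiplier `k` with `p ∤ k`: `k Λ_{E₀} ⊆ Λ_E`.**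
A cyclic `ℚ`-isogeny `ψ : E → E₀` (Silverman AEC III.4.11, the tree's `IsIsogenous.exists_isCyclic`,
run between the short models `E_Λ`, `E_{Λ₀}` of the two curves) has `p ∤ deg ψ`
(`not_dvd_degree_of_isCyclic_of_irr`; irreducibility is invariant under a change of equation,
`hasIrreducibleModPGaloisRep_smul_iff`); its rational multiplier `q` has `qΛ ⊆ Λ₀` and
`[Λ₀ : qΛ] = deg ψ` (Silverman AEC VI.4.1(b), the tree's
`degree_eq_natCard_ker_mulQuotientMap_of_baseChange_eq_curve`), so `(deg ψ / q) Λ₀ ⊆ Λ` (Lagrange on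
the kernel); the Néron mapping property for the two minimal models
(`integral_neronScaling_of_isGloballyMinimal`, Silverman ATAEC IV.5.1, IV.6.1, Cor. IV.9.1) makes
`q` and `k = deg ψ / q` integers, whence `k ∣ deg ψ` and `p ∤ k`. (The tree's
`exists_int_mul_mem_lattice_natAbs_le_163` is the same computation with Mazur–Kenku in place of
irreducibility.) [cite: SilvermanAEC2009, Cor. III.4.11 and Thm. VI.4.1(b)]
[cite: SilvermanATAEC1994, IV.5.1 with IV.6.1 and Cor. IV.9.1] -/
theorem exists_int_mul_mem_lattice_not_dvd (hNS : integral_neronScaling_of_isGloballyMinimal)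
    {W₀ W : WeierstrassCurve ℚ} [W₀.IsElliptic] [W.IsElliptic] [W₀.IsGloballyMinimal]
    [W.IsGloballyMinimal] (hiso : IsIsogenous W₀ W) {L₀ L : PeriodPair}
    (hL₀ : IsNeronLatticeOf (W₀.baseChange ℂ) L₀) (hL : IsNeronLatticeOf (W.baseChange ℂ) L)
    {p : ℕ} (hp : p.Prime) (hirr : W.HasIrreducibleModPGaloisRep p) :
    ∃ k : ℤ, k ≠ 0 ∧ ¬ (p : ℤ) ∣ k ∧ ∀ z ∈ L₀.lattice, (k : ℂ) * z ∈ L.lattice := by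
  -- the short models are `E_{Λ₀}`, `E_Λ` after base change, and are `ℚ`-isogenous
  set C₀ : VariableChange ℚ := ⟨1, -W₀.b₂ / 12, -W₀.a₁ / 2, W₀.a₁ * W₀.b₂ / 24 - W₀.a₃ / 2⟩
    with hC₀
  set C : VariableChange ℚ := ⟨1, -W.b₂ / 12, -W.a₁ / 2, W.a₁ * W.b₂ / 24 - W.a₃ / 2⟩ with hC
  have hE₀ : (C₀ • W₀).baseChange ℂ = L₀.curve := shortModel_baseChange_eq_curve W₀ hL₀
  have hE : (C • W).baseChange ℂ = L.curve := shortModel_baseChange_eq_curve W hL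
  have h : IsIsogenous (C • W) (C₀ • W₀) :=
    (isIsogenous_of_smul W C).trans' (hiso.symm_of_charZero.trans' (isIsogenous_smul W₀ C₀))
  -- a cyclic `ℚ`-isogeny `ψ : C • W → C₀ • W₀`; `p ∤ deg ψ` since `(C • W)[p] ≅ E[p]` is irreducible
  obtain ⟨ψ, hψ⟩ := h.exists_isCyclic
  have hirrC : (C • W).HasIrreducibleModPGaloisRep p :=
    (Mazur1978.hasIrreducibleModPGaloisRep_smul_iff W C p).mpr hirr
  have hpdeg : ¬ p ∣ ψ.degree := not_dvd_degree_of_isCyclic_of_irr ψ hψ hp hirrC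
  have hpos : 0 < ψ.degree := ψ.degree_pos
  -- its rational multiplier `q`: `qΛ ⊆ Λ₀`, `#ker(z ↦ qz) = deg ψ`
  obtain ⟨q, hq0, hq, hdegq⟩ :=
    degree_eq_natCard_ker_mulQuotientMap_of_baseChange_eq_curve ψ hE hE₀
  -- `q ∈ ℤ`: the Néron mapping property between the two minimal models
  obtain ⟨k', hk'⟩ := hNS W W₀ L L₀ hL hL₀ q hq
  -- `(d/q) Λ₀ ⊆ Λ` (Lagrange on the kernel), so `d/q ∈ ℤ` as well
  have hqC : (q : ℂ) ≠ 0 := by exact_mod_cast hq0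
  have hq' : ∀ z ∈ L₀.lattice, (((ψ.degree : ℚ) / q : ℚ) : ℂ) * z ∈ L.lattice := fun z hz ↦ by
    have hmem := mul_inv_mul_mem_of_natCard_ker_mulQuotientMap (Λ₀ := L.lattice.toAddSubgroup)
      (Λ := L₀.lattice.toAddSubgroup) hqC (hq := hq) (show z ∈ L₀.lattice.toAddSubgroup from hz)
    rw [← hdegq] at hmem
    have hcast : (((ψ.degree : ℚ) / q : ℚ) : ℂ) * z = (ψ.degree : ℂ) * ((q : ℂ)⁻¹ * z) := by
      push_cast
      field_simp
    rw [hcast]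
    exact hmem
  obtain ⟨k, hk⟩ := hNS W₀ W L₀ L hL₀ hL _ hq'
  -- `k' k = d`, hence `k ∣ d` and `p ∤ k`
  have hkk' : k' * k = ψ.degree := by
    have h1 : (k' : ℚ) * k = ψ.degree := by rw [hk, hk', mul_div_cancel₀ _ hq0]
    exact_mod_cast h1
  have hk0 : k ≠ 0 := by
    rintro rfl
    rw [mul_zero] at hkk'
    exact hpos.ne' (by exact_mod_cast hkk'.symm)
  refine ⟨k, hk0, fun hpk ↦ hpdeg ?_, fun z hz ↦ ?_⟩
  · have h1 : (p : ℤ) ∣ (ψ.degree : ℤ) := hkk' ▸ dvd_mul_of_dvd_right hpk k'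
    exact Int.natCast_dvd_natCast.mp h1
  · have h1 := hq' z hz
    rwa [← hk, Rat.cast_intCast] at h1

/-! ### A modular-parametrisation datum with Manin constant prime to `p` -/

/-- **A datum of `E` at level `N` with Manin constant prime to `p`**, for a globally minimal elliptic
`W/ℚ` of conductor `N`, an odd prime `p` with `p² ∤ N` and `E[p]` irreducible (Jetchev–Skinner–Wan
2017, Remark 43 / §7.4.1: "`c_E ∈ ℤ` is the Manin constant of `E` (so `p ∤ c_E` in this case)").
Inputs: the Modularity theorem (`hnf`, giving the optimal curve `W₀ ~ W` and its datum `D₀` of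
minimal degree, `exists_optimal_modularParametrizationData_of_modularity`; minimal degree forces
`Λ_{W₀} = c₀ Λ_f`, the tree's `exists_optimalDatum'` + `latticeEq_of_modularDegree_le`), **Mazur
1978, Cor. 4.1** (`hMaz`: `p ∤ c₀`), and the Néron mapping property (`hNS`, through
`exists_int_mul_mem_lattice_not_dvd`: an integral multiplier `k : Λ_{W₀} → Λ_W` with `p ∤ k`); the
datum is `(f, Λ_W, k c₀)` (`ModularParametrizationData.exists_of_isNewformOf`).
[cite: Mazur1978, Cor. 4.1] [cite: JetchevSkinnerWan2017, §7.4.1 (p. 30) and Remark 43]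
[cite: AgasheRibetStein2006, Thm. 2.6 and §2] -/
theorem exists_modularParametrizationData_not_dvd (hnf : exists_isNewformOf)
    (hMaz : mazur_not_dvd_maninConstant_of_odd) (hNS : integral_neronScaling_of_isGloballyMinimal)
    (W : WeierstrassCurve ℚ) [W.IsElliptic] [W.IsGloballyMinimal] {N : ℕ} [NeZero N]
    (hN : W.conductorNorm ℤ = N) {p : ℕ} (hp : p.Prime) (hp2 : p ≠ 2) (hpN : ¬ p ^ 2 ∣ N)
    (hirr : W.HasIrreducibleModPGaloisRep p) :
    ∃ Dt : ModularParametrizationData W N, ¬ (p : ℤ) ∣ Dt.c := by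
  haveI : (W.baseChange ℂ).IsElliptic := by rw [WeierstrassCurve.baseChange]; infer_instance
  -- the optimal curve `W₀ ~ W` of the class, with its datum `D₀` of minimal degree
  obtain ⟨W₀, hW₀, hW₀min, D₀, hfW, hisoW, hmin⟩ :=
    exists_optimal_modularParametrizationData_of_modularity hnf N W hN
  haveI := hW₀
  haveI := hW₀min
  -- minimal degree forces lattice-optimality `Λ_{W₀} = c₀ Λ_f`
  obtain ⟨W₁, hW₁, D₁, hf₁, h₁⟩ := D₀.exists_optimalDatum'
  haveI := hW₁
  have hopt : ∀ z ∈ D₀.L.lattice, ∃ w ∈ periodLattice D₀.f, z = D₀.c * w :=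
    D₀.latticeEq_of_modularDegree_le D₁ hf₁ h₁ (hmin W₁ D₁ hf₁)
  -- Mazur 1978, Cor. 4.1: `p ∤ c₀`
  have hc₀ : ¬ (p : ℤ) ∣ D₀.c := hMaz W₀ D₀ hopt p hp hp2 hpN
  -- an integral multiplier `k : Λ_{W₀} → Λ_W` prime to `p`
  obtain ⟨LW, hLW⟩ := exists_isNeronLatticeOf_holds (W.baseChange ℂ)
  obtain ⟨k, hk0, hpk, hk⟩ :=
    exists_int_mul_mem_lattice_not_dvd hNS hisoW.symm_of_charZero D₀.isNeronLattice hLW hp hirr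
  -- the datum `(f, Λ_W, k c₀)` of `W`
  have hm0 : k * D₀.c ≠ 0 := mul_ne_zero hk0 D₀.maninConstant_ne_zero_holds
  have hle : ∀ z ∈ periodLattice D₀.f, ((k * D₀.c : ℤ) : ℂ) * z ∈ LW.lattice := fun z hz ↦ by
    have h2 := hk _ (D₀.smul_periodLattice_le z hz)
    rwa [← mul_assoc, ← Int.cast_mul] at h2
  obtain ⟨D, -, -, hDc⟩ := ModularParametrizationData.exists_of_isNewformOf hfW hLW hm0 hle
  refine ⟨D, fun hdvd ↦ ?_⟩
  rw [hDc] at hdvd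
  rcases (Nat.prime_iff_prime_int.mp hp).dvd_or_dvd hdvd with h | h
  · exact hpk h
  · exact hc₀ h

/-! ### The binder `hMan` of `BDPRouteFinal` discharged -/

/-- **The Manin-unit Heegner datum (the binder `hMan` of
`bsdp_of_classX11b_of_locus_of_maninDatum`, discharged).** For every globally minimal elliptic `W/ℚ`
of conductor `N`, prime `p ≥ 5` of multiplicative reduction (so `p² ∤ N`, the tree's
`not_sq_dvd_conductorNorm_of_mult`) with `E[p]` irreducible, and imaginary quadratic `K` satisfying
the Heegner hypothesis for `N`: a datum `Dt` of `W` at level `N` with `p ∤ c`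
(`exists_modularParametrizationData_not_dvd`: modularity, Mazur 1978 Cor. 4.1, Néron mapping
property), a Heegner datum `H` of discriminant `d_K` (tree theorems `exists_dvd_sq_sub_discr_holds`,
`nonempty_heegnerDatum_holds`: Gross 1984 §I.1), an embedding `ι : K → ℂ`, and a point `P ∈ E(K)`
mapping to the Heegner point `∑_Q φ(τ_Q)` (tree theorem `heegnerPointComplex_mem_range_map_holds`:
Darmon 2004, Thm. 3.6). [cite: Mazur1978, Cor. 4.1] [cite: Darmon2004, Thm. 3.6 and §3.7]
[cite: JetchevSkinnerWan2017, §7.4.1 (p. 30) and Remark 43] -/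
theorem exists_maninDatum (hnf : exists_isNewformOf) (hMaz : mazur_not_dvd_maninConstant_of_odd)
    (hNS : integral_neronScaling_of_isGloballyMinimal) :
    ∀ (W : WeierstrassCurve ℚ) [W.IsElliptic] [W.IsGloballyMinimal] (p : ℕ) [Fact p.Prime]
      (N : ℕ) [NeZero N] (K : Type) [Field K] [NumberField K],
      W.conductorNorm ℤ = N → 5 ≤ p → W.HasMultiplicativeReductionAtPrime p →
      W.HasIrreducibleModPGaloisRep p → IsImaginaryQuadratic K → SatisfiesHeegnerHypothesis N K →
      ∃ (Dt : ModularParametrizationData W N) (H : HeegnerDatum N (NumberField.discr K))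
        (ι : K →+* ℂ) (P : (W.baseChange K).toAffine.Point),
        WeierstrassCurve.Affine.Point.map ι.toRatAlgHom P = heegnerPointComplex Dt H ∧
          ¬ (p : ℤ) ∣ Dt.c := by
  intro W _ _ p _ N _ K _ _ hN hp5 hmult hirr hK hH
  have hp : p.Prime := Fact.out
  have hp2 : p ≠ 2 := by omega
  have hpN : ¬ p ^ 2 ∣ N := hN ▸ not_sq_dvd_conductorNorm_of_mult W p hmult
  obtain ⟨Dt, hDt⟩ := exists_modularParametrizationData_not_dvd hnf hMaz hNS W hN hp hp2 hpN hirr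
  obtain ⟨β, hβ⟩ := exists_dvd_sq_sub_discr_holds N K hK hH
  obtain ⟨H, -⟩ := nonempty_heegnerDatum_holds N K hK hβ
  obtain ⟨ι⟩ : Nonempty (K →+* ℂ) := inferInstance
  obtain ⟨P, hP⟩ := heegnerPointComplex_mem_range_map_holds N W K hK hH Dt H ι
  exact ⟨Dt, H, ι, P, hP, hDt⟩

/-! ### The sub-cell target from STEP L and published facts alone -/

/-- **The sub-cell target from STEP L and published facts alone.** For every `(E,p)` in X11b
(`r_an = 1`, `p` odd, multiplicative at `p`, `E[p]` irreducible) on the `Locus` (`p ≥ 5`, a (ram)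
prime, `p ∤ ∏ c_ℓ`): `BSD(E,p)` — from the typed input STEP L (`hL`: `IndexLowerBoundAt` at every
Heegner datum with Manin constant prime to `p`; OPEN at `p ∥ N`, no refereed proof) and the PUBLISHED
named facts of the tree `hGZ`, `hKo`, `hB`, `hSk`, `hGZK`, `hmod`, `hnf`, `hFH`, `hMaz` (Mazur 1978
Cor. 4.1) and `hNS` (Néron mapping property for minimal models, Silverman ATAEC IV). Obtained from
`bsdp_of_classX11b_of_locus_of_maninDatum` by discharging its last binder `hMan` with
`exists_maninDatum`. CONDITIONAL on STEP L only; X11b stays CONSTRUCTION-SHAPED.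
[cite: JetchevSkinnerWan2017, §7.4.1 (pp. 29–31) and Remark 43] [cite: Skinner2016PacificMC, Thm. C (§1)]
[cite: Mazur1978, Cor. 4.1] [cite: Miller2011LMS, Def. 1.1] -/
theorem bsdp_of_classX11b_of_locus
    -- published inputs (named facts of the tree)
    (hGZ : ∀ (N : ℕ) [NeZero N] (W : WeierstrassCurve ℚ) (K : Type) [Field K] [NumberField K],
      gross_zagier N W K)
    (hKo : ∀ (N : ℕ) [NeZero N] (W : WeierstrassCurve ℚ) (K : Type) [Field K] [NumberField K],
      kolyvagin N W K)
    (hB : ∀ (N : ℕ) [NeZero N] (W : WeierstrassCurve ℚ) (K : Type) [Field K] [NumberField K],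
      Kolyvagin1990_padicValNat_card_sha_le N W K)
    (hSk : Skinner2016.thmC_padicValRat_bsd_rank_zero)
    (hGZK : rank_eq_analyticRank_of_analyticRank_le_one) (hmod : hasEntireLFunction_rat)
    (hnf : exists_isNewformOf)
    (hFH : friedbergHoffstein_exists_heegnerField_split_twist_ne_zero)
    (hMaz : mazur_not_dvd_maninConstant_of_odd) (hNS : integral_neronScaling_of_isGloballyMinimal)
    -- the typed input of the route (STEP L), at every Heegner datum with Manin constant prime to `p`
    (hL : ∀ (W : WeierstrassCurve ℚ) [W.IsElliptic] [W.IsGloballyMinimal] (p : ℕ) [Fact p.Prime]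
      (N : ℕ) [NeZero N] (K : Type) [Field K] [NumberField K]
      (Dt : ModularParametrizationData W N) (H : HeegnerDatum N (NumberField.discr K)) (ι : K →+* ℂ)
      (P : (W.baseChange K).toAffine.Point),
      ClassX11b W p → Locus W p → W.conductorNorm ℤ = N → IsImaginaryQuadratic K →
      SatisfiesHeegnerHypothesis N K →
      WeierstrassCurve.Affine.Point.map ι.toRatAlgHom P = heegnerPointComplex Dt H →
      ¬ (p : ℤ) ∣ Dt.c → IndexLowerBoundAt W p K P) :
    ∀ (W : WeierstrassCurve ℚ) [W.IsElliptic] [W.IsGloballyMinimal] (p : ℕ) [Fact p.Prime],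
      ClassX11b W p → Locus W p → BSDp W p :=
  bsdp_of_classX11b_of_locus_of_maninDatum hGZ hKo hB hSk hGZK hmod hnf hFH
    (exists_maninDatum hnf hMaz hNS) hL

/-- **`X11b.Statement` from STEP L and published facts alone.** The sub-cell target of record
(`@[conjecture] def Statement`, `X11b/BDPRoute.lean`; nothing asserted there) follows from STEP L
(`hL`) and the published named facts of the tree — `statement_of_indexLowerBoundAt_of_maninDatum`
with its binder `hMan` discharged by `exists_maninDatum` (modularity, Mazur 1978 Cor. 4.1, Néron
mapping property). No transport binder remains: the route is CONDITIONAL on STEP L and on nothing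
else unpublished; X11b stays CONSTRUCTION-SHAPED (STEP L has no refereed proof at `p ∥ N`).
[cite: JetchevSkinnerWan2017, §7.4.1 (pp. 29–31) and Remark 43] [cite: Mazur1978, Cor. 4.1]
[cite: Miller2011LMS, Def. 1.1] -/
theorem statement_of_indexLowerBoundAt
    -- published inputs (named facts of the tree)
    (hGZ : ∀ (N : ℕ) [NeZero N] (W : WeierstrassCurve ℚ) (K : Type) [Field K] [NumberField K],
      gross_zagier N W K)
    (hKo : ∀ (N : ℕ) [NeZero N] (W : WeierstrassCurve ℚ) (K : Type) [Field K] [NumberField K],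
      kolyvagin N W K)
    (hB : ∀ (N : ℕ) [NeZero N] (W : WeierstrassCurve ℚ) (K : Type) [Field K] [NumberField K],
      Kolyvagin1990_padicValNat_card_sha_le N W K)
    (hSk : Skinner2016.thmC_padicValRat_bsd_rank_zero)
    (hGZK : rank_eq_analyticRank_of_analyticRank_le_one) (hmod : hasEntireLFunction_rat)
    (hnf : exists_isNewformOf)
    (hFH : friedbergHoffstein_exists_heegnerField_split_twist_ne_zero)
    (hMaz : mazur_not_dvd_maninConstant_of_odd) (hNS : integral_neronScaling_of_isGloballyMinimal)
    -- the typed input of the route (STEP L), at every Heegner datum with Manin constant prime to `p`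
    (hL : ∀ (W : WeierstrassCurve ℚ) [W.IsElliptic] [W.IsGloballyMinimal] (p : ℕ) [Fact p.Prime]
      (N : ℕ) [NeZero N] (K : Type) [Field K] [NumberField K]
      (Dt : ModularParametrizationData W N) (H : HeegnerDatum N (NumberField.discr K)) (ι : K →+* ℂ)
      (P : (W.baseChange K).toAffine.Point),
      ClassX11b W p → Locus W p → W.conductorNorm ℤ = N → IsImaginaryQuadratic K →
      SatisfiesHeegnerHypothesis N K →
      WeierstrassCurve.Affine.Point.map ι.toRatAlgHom P = heegnerPointComplex Dt H →
      ¬ (p : ℤ) ∣ Dt.c → IndexLowerBoundAt W p K P) :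
    Statement :=
  statement_of_indexLowerBoundAt_of_maninDatum hGZ hKo hB hSk hGZK hmod hnf hFH
    (exists_maninDatum hnf hMaz hNS) hL

end Summit.BirchSwinnertonDyer.Rank1Residual.X11b

end
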